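import Literature.AlgebraicTopology.SingularHomology.CircleProductBetti
import Literature.AlgebraicTopology.SingularHomology.TorusCohomology
import HarnessLib

/-!
# The homology of `S¹ × K` splits: `Hₖ₊₁(S¹ × K; M) ≅ Hₖ₊₁(K; M) ⊕ Hₖ(K; M)`, all coefficients;
# `Hₖ(Tⁿ; M) ≅ M^(n choose k)`

A. Hatcher, *Algebraic Topology* (2002), §2.1 (exact sequence of the pair, retractions:
"if `r : X → A` is a retraction then `i_*` is injective", p. 115 / Ex. 2.1.11) and §3.B Thm. 3B.6,
Cor. 3B.7 (Künneth); §3.3 p. 231: "`Hₖ(Tⁿ; ℤ)` is isomorphic to the direct sum of `(n choose k)`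
copies of `ℤ`". Sequel of `CircleProductBetti.lean` (the pair `(S¹ × K, D × K)`, `D = B̄(0, ¼)`, with
`Hₙ(D × K) ≅ Hₙ(K)`, `Hₙ₊₁(S¹ × K, D × K) ≅ Hₙ(K)`, `H₀(S¹ × K, D × K) = 0`), which only drew the
rank INEQUALITY from the exact sequence. Here the sequence is SPLIT, for every commutative ring `R`,
every `R`-module `M` and every space `K`:

* `circleArcRetraction` — the retraction `ρ : S¹ → D`, `θ ↦ θ` on `D` and `θ ↦ [½] - θ` on the
  opposite arc (continuous: the two formulas agree at `±¼`), and `circleArcStripRetraction`, the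
  retraction `r = ρ × 𝟙 : S¹ × K → D × K` of the inclusion (`circleArcStripRetraction_comp_incl`);
* hence `i_* : Hₖ(D × K) → Hₖ(S¹ × K)` is a split injection (`map_incl_injective`), the connecting
  maps of the pair vanish (`δ_eq_zero`), `j_* : Hₖ(S¹ × K) → Hₖ(S¹ × K, D × K)` is onto
  (`ofAbsolute_surjective`) and `x ↦ (r_* x, j_* x)` is a linear isomorphism
  `Hₖ(S¹ × K) ≅ Hₖ(D × K) × Hₖ(S¹ × K, D × K)` (`splitEquiv`);
* composing with the isomorphisms of `CircleProductBetti.lean`: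
  **`nonempty_singularHomology_circleProd_equiv_succ`** `Hₖ₊₁(S¹ × K; M) ≃ₗ[R] Hₖ₊₁(K; M) × Hₖ(K; M)`,
  **`nonempty_singularHomology_circleProd_equiv_zero`** `H₀(S¹ × K; M) ≃ₗ[R] H₀(K; M)`, and the
  same with the factors swapped (`…prodCircle…`);
* by induction through `Tⁿ⁺¹ ≃ Tⁿ × S¹` (`torusSplit`, `TorusCohomology.lean`):
  **`nonempty_singularHomology_torus_equiv`** — `Hₖ(Tⁿ; M) ≃ₗ[R] (Fin (n choose k) → M)` for EVERY
  coefficient module `M` (Hatcher §3.3 p. 231 for `M = ℤ`): the homology of the torus is free of rank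
  `(n choose k)` over any ring.

Everything is proved; no named facts.

## References

* A. Hatcher, *Algebraic Topology*, CUP 2002, §2.1 p. 115 and Exercise 11 (retractions), p. 118
  (exact sequence of the pair); §3.B Thm. 3B.6, Cor. 3B.7; §3.3 p. 231. [HatcherAT2002]
-/

noncomputable section

open CategoryTheory Limits Set Metric

universe u v

namespace Literature.AlgebraicTopology.SingularHomology

/-! ### The retraction of the circle onto the closed quarter arc -/

section Retraction

/-- At the two end points `±¼` of the arc `D = B̄(0, ¼) ⊂ ℝ/ℤ` the reflection `θ ↦ [½] - θ` is the
identity. [folklore] -/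
theorem eq_half_sub_of_norm_eq_quarter {θ : AddCircle (1 : ℝ)} (h : ‖θ‖ = 1 / 4) :
    θ = ((1 / 2 : ℝ) : AddCircle (1 : ℝ)) - θ := by
  have hmem : θ ∈ closedBall (((0 : ℝ)) : AddCircle (1 : ℝ)) (1 / 4) := by
    rw [QuotientAddGroup.mk_zero, mem_closedBall, dist_zero_right, h]
  obtain ⟨x, hx, rfl⟩ := exists_coe_eq_of_mem_closedBall_unitAddCircle hmem
  rw [norm_coe_eq_abs_unitAddCircle (abs_le.2 ⟨by linarith [hx.1], by linarith [hx.2]⟩)] at h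
  rcases (abs_eq (by norm_num : (0 : ℝ) ≤ 1 / 4)).1 h with hx' | hx'
  · rw [hx', ← AddCircle.coe_sub]
    norm_num
  · rw [hx', ← AddCircle.coe_sub, ← AddCircle.coe_add_period 1 (-(1 / 4) : ℝ)]
    norm_num

/-- **The retraction `ρ : ℝ/ℤ → D` onto the closed quarter arc** `D = B̄(0, ¼)`: the identity on `D`,
the reflection `θ ↦ [½] - θ` on the opposite arc (Hatcher 2002, §2.1: a retraction `X → A`).
[cite: HatcherAT2002, §2.1 p. 115] -/
def circleArcRetractionFun (θ : AddCircle (1 : ℝ)) : AddCircle (1 : ℝ) :=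
  if ‖θ‖ ≤ 1 / 4 then θ else ((1 / 2 : ℝ) : AddCircle (1 : ℝ)) - θ

/-- `ρ` is continuous (the two formulas agree where `‖θ‖ = ¼`). [cite: HatcherAT2002, §2.1 p. 115] -/
theorem continuous_circleArcRetractionFun : Continuous circleArcRetractionFun := by
  have hg : Continuous fun θ : AddCircle (1 : ℝ) => ((1 / 2 : ℝ) : AddCircle (1 : ℝ)) - θ := by
    fun_prop
  exact continuous_if_le continuous_norm continuous_const continuous_id.continuousOn hg.continuousOn
    (fun _ h => eq_half_sub_of_norm_eq_quarter h)

/-- `ρ` takes values in `D`. [cite: HatcherAT2002, §2.1 p. 115] -/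
theorem circleArcRetractionFun_mem (θ : AddCircle (1 : ℝ)) :
    circleArcRetractionFun θ ∈ closedBall (0 : AddCircle (1 : ℝ)) (1 / 4) := by
  unfold circleArcRetractionFun
  split_ifs with h
  · rwa [mem_closedBall, dist_zero_right]
  · rw [mem_closedBall, dist_zero_right, ← norm_neg, neg_sub, norm_sub_coe_half_unitAddCircle]
    linarith [not_le.1 h]

/-- `ρ` is the identity on `D`. [cite: HatcherAT2002, §2.1 p. 115] -/
theorem circleArcRetractionFun_of_mem {θ : AddCircle (1 : ℝ)} (h : θ ∈ closedBall (0 : AddCircle (1 : ℝ)) (1 / 4)) :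
    circleArcRetractionFun θ = θ := by
  rw [mem_closedBall, dist_zero_right] at h
  exact if_pos h

variable {K : Type u} [TopologicalSpace K]

/-- **The retraction `r = ρ × 𝟙 : S¹ × K → D × K`** of the strip inclusion. [cite: HatcherAT2002, §2.1 p. 115] -/
def circleArcStripRetraction : C(AddCircle (1 : ℝ) × K, circleArcStrip K) where
  toFun p := ⟨(circleArcRetractionFun p.1, p.2), circleArcRetractionFun_mem p.1⟩
  continuous_toFun := ((continuous_circleArcRetractionFun.comp continuous_fst).prodMk continuous_snd).subtype_mk _

/-- `r ∘ incl = 𝟙`. [cite: HatcherAT2002, §2.1 p. 115] -/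
theorem circleArcStripRetraction_comp_incl :
    (circleArcStripRetraction (K := K)).comp ⟨Subtype.val, continuous_subtype_val⟩ =
      ContinuousMap.id (circleArcStrip K) :=
  ContinuousMap.ext fun p => Subtype.ext (Prod.ext (circleArcRetractionFun_of_mem p.2) rfl)

end Retraction

/-! ### The split exact sequence of the pair `(S¹ × K, D × K)` -/

section Split

variable (R : Type v) [CommRing R] (M : Type v) [AddCommGroup M] [Module R M]
variable {K : Type u} [TopologicalSpace K]

/-- The inclusion `D × K ↪ S¹ × K` as a continuous map. [folklore] -/
abbrev circleArcStripIncl : C(circleArcStrip K, AddCircle (1 : ℝ) × K) :=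
  ⟨Subtype.val, continuous_subtype_val⟩

/-- `r_* i_* = 𝟙` on `Hₖ(D × K; M)`. [cite: HatcherAT2002, §2.1 p. 115] -/
theorem map_circleArcStripRetraction_map_incl (k : ℕ) (a : singularHomology R M (circleArcStrip K) k) :
    singularHomology.map R M circleArcStripRetraction k
        (singularHomology.map R M (circleArcStripIncl (K := K)) k a) = a := by
  change (singularHomology.map R M (circleArcStripIncl (K := K)) k ≫
    singularHomology.map R M circleArcStripRetraction k) a = a
  rw [← singularHomology.map_comp, circleArcStripRetraction_comp_incl, singularHomology.map_id]
  rfl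

/-- **`i_* : Hₖ(D × K) → Hₖ(S¹ × K)` is injective** (split by the retraction; Hatcher 2002, §2.1
p. 115). [cite: HatcherAT2002, §2.1 p. 115] -/
theorem map_circleArcStripIncl_injective (k : ℕ) :
    Function.Injective (singularHomology.map R M (circleArcStripIncl (K := K)) k) :=
  Function.LeftInverse.injective (map_circleArcStripRetraction_map_incl R M k)

/-- **The connecting maps of the pair `(S¹ × K, D × K)` vanish** (`im ∂ = ker i_* = 0`).
[cite: HatcherAT2002, §2.1 p. 118] -/
theorem δ_circleArcStrip_eq_zero (k : ℕ) :
    relativeSingularHomology.δ R M (AddCircle (1 : ℝ) × K) (circleArcStrip K) k = 0 := by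
  have hS := relativeSingularHomology.exact_δ_map R M (X := AddCircle (1 : ℝ) × K) (circleArcStrip K) k
  have hr := hS.moduleCat_range_eq_ker
  dsimp only at hr
  rw [LinearMap.ker_eq_bot.2 (map_circleArcStripIncl_injective R M k), LinearMap.range_eq_bot] at hr
  ext x
  exact congrFun (congrArg DFunLike.coe hr) x

/-- **`j_* : Hₖ(S¹ × K) → Hₖ(S¹ × K, D × K)` is surjective** (`im j_* = ker ∂ = everything` in
positive degrees; the target vanishes in degree `0`). [cite: HatcherAT2002, §2.1 p. 118] -/
theorem ofAbsolute_circleArcStrip_surjective (k : ℕ) :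
    Function.Surjective
      (relativeSingularHomology.ofAbsolute R M (AddCircle (1 : ℝ) × K) (circleArcStrip K) k) := by
  cases k with
  | zero =>
    haveI := ModuleCat.subsingleton_of_isZero (isZero_relativeSingularHomology_circleArcStrip_zero R M (K := K))
    exact fun c => ⟨0, Subsingleton.elim _ _⟩
  | succ k =>
    have hS := relativeSingularHomology.exact_ofAbsolute_δ R M (X := AddCircle (1 : ℝ) × K) (circleArcStrip K) k
    have hr := hS.moduleCat_range_eq_ker
    have hker : LinearMap.ker
        (relativeSingularHomology.δ R M (AddCircle (1 : ℝ) × K) (circleArcStrip K) k).hom = ⊤ := by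
      rw [δ_circleArcStrip_eq_zero]
      exact LinearMap.ker_zero
    exact LinearMap.range_eq_top.1 (hr.trans hker)

/-- Exactness at `Hₖ(S¹ × K)`: `im i_* = ker j_*`. [cite: HatcherAT2002, §2.1 p. 118] -/
theorem range_map_circleArcStripIncl_eq_ker (k : ℕ) :
    LinearMap.range (singularHomology.map R M (circleArcStripIncl (K := K)) k).hom =
      LinearMap.ker (relativeSingularHomology.ofAbsolute R M (AddCircle (1 : ℝ) × K) (circleArcStrip K) k).hom := by
  have hS := relativeSingularHomology.exact_map_ofAbsolute R M (X := AddCircle (1 : ℝ) × K) (circleArcStrip K) k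
  exact hS.moduleCat_range_eq_ker

/-- **The splitting map** `x ↦ (r_* x, j_* x) : Hₖ(S¹ × K) → Hₖ(D × K) × Hₖ(S¹ × K, D × K)`.
[cite: HatcherAT2002, §2.1 p. 118] -/
def circleArcStripSplitMap (k : ℕ) :
    singularHomology R M (AddCircle (1 : ℝ) × K) k →ₗ[R]
      singularHomology R M (circleArcStrip K) k ×
        relativeSingularHomology R M (AddCircle (1 : ℝ) × K) (circleArcStrip K) k :=
  LinearMap.prod (singularHomology.map R M circleArcStripRetraction k).hom
    (relativeSingularHomology.ofAbsolute R M (AddCircle (1 : ℝ) × K) (circleArcStrip K) k).hom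

/-- The splitting map is injective: `r_* x = 0`, `j_* x = 0` force `x = i_* a` with
`a = r_* i_* a = 0`. [cite: HatcherAT2002, §2.1 p. 118] -/
theorem circleArcStripSplitMap_injective (k : ℕ) :
    Function.Injective (circleArcStripSplitMap R M (K := K) k) := by
  rw [injective_iff_map_eq_zero]
  intro x hx
  obtain ⟨h1, h2⟩ := Prod.mk_eq_zero.1 hx
  have hx' : x ∈ LinearMap.ker
      (relativeSingularHomology.ofAbsolute R M (AddCircle (1 : ℝ) × K) (circleArcStrip K) k).hom := h2
  rw [← range_map_circleArcStripIncl_eq_ker] at hx'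
  obtain ⟨a, rfl⟩ := hx'
  have ha : a = 0 := by rw [← map_circleArcStripRetraction_map_incl R M k a]; exact h1
  rw [ha, map_zero]

/-- The splitting map is surjective: given `(a, c)` pick `x₀` with `j_* x₀ = c` and correct by
`i_*(a - r_* x₀)`. [cite: HatcherAT2002, §2.1 p. 118] -/
theorem circleArcStripSplitMap_surjective (k : ℕ) :
    Function.Surjective (circleArcStripSplitMap R M (K := K) k) := by
  rintro ⟨a, c⟩
  obtain ⟨x₀, rfl⟩ := ofAbsolute_circleArcStrip_surjective R M k c
  refine ⟨x₀ + singularHomology.map R M (circleArcStripIncl (K := K)) k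
    (a - singularHomology.map R M circleArcStripRetraction k x₀), ?_⟩
  have hj : relativeSingularHomology.ofAbsolute R M (AddCircle (1 : ℝ) × K) (circleArcStrip K) k
      (singularHomology.map R M (circleArcStripIncl (K := K)) k
        (a - singularHomology.map R M circleArcStripRetraction k x₀)) = 0 := by
    have hm : singularHomology.map R M (circleArcStripIncl (K := K)) k
        (a - singularHomology.map R M circleArcStripRetraction k x₀) ∈
        LinearMap.ker (relativeSingularHomology.ofAbsolute R M (AddCircle (1 : ℝ) × K) (circleArcStrip K) k).hom := by
      rw [← range_map_circleArcStripIncl_eq_ker]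
      exact LinearMap.mem_range_self _ _
    exact hm
  refine Prod.ext ?_ ?_
  · change singularHomology.map R M circleArcStripRetraction k _ = a
    rw [map_add, map_circleArcStripRetraction_map_incl, add_sub_cancel]
  · change relativeSingularHomology.ofAbsolute R M _ _ k _ = _
    rw [map_add, hj, add_zero]

/-- **The homology of `S¹ × K` splits**: `x ↦ (r_* x, j_* x)` is a linear isomorphism
`Hₖ(S¹ × K; M) ≃ Hₖ(D × K; M) × Hₖ(S¹ × K, D × K; M)`. [cite: HatcherAT2002, §2.1 p. 118] -/
def circleArcStripSplitEquiv (k : ℕ) :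
    singularHomology R M (AddCircle (1 : ℝ) × K) k ≃ₗ[R]
      singularHomology R M (circleArcStrip K) k ×
        relativeSingularHomology R M (AddCircle (1 : ℝ) × K) (circleArcStrip K) k :=
  LinearEquiv.ofBijective (circleArcStripSplitMap R M k)
    ⟨circleArcStripSplitMap_injective R M k, circleArcStripSplitMap_surjective R M k⟩

/-- **`Hₖ₊₁(S¹ × K; M) ≅ Hₖ₊₁(K; M) ⊕ Hₖ(K; M)`** for every space `K` and all coefficients
(Hatcher 2002, Thm. 3B.6 / Cor. 3B.7 for a circle factor, here from the split pair sequence).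
[cite: HatcherAT2002, §3.B Cor. 3B.7] -/
theorem nonempty_singularHomology_circleProd_equiv_succ (k : ℕ) :
    Nonempty (singularHomology R M (AddCircle (1 : ℝ) × K) (k + 1) ≃ₗ[R]
      singularHomology R M K (k + 1) × singularHomology R M K k) := by
  obtain ⟨eA⟩ := nonempty_singularHomology_arcStrip_iso R M (K := K) (k + 1)
  obtain ⟨eC⟩ := nonempty_relativeSingularHomology_circleArcStrip_iso R M (K := K) k
  exact ⟨circleArcStripSplitEquiv R M (k + 1) ≪≫ₗ eA.toLinearEquiv.prodCongr eC.toLinearEquiv⟩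

/-- **`H₀(S¹ × K; M) ≅ H₀(K; M)`** (the relative term vanishes in degree `0`). [cite: HatcherAT2002, §3.B Cor. 3B.7] -/
theorem nonempty_singularHomology_circleProd_equiv_zero :
    Nonempty (singularHomology R M (AddCircle (1 : ℝ) × K) 0 ≃ₗ[R] singularHomology R M K 0) := by
  obtain ⟨eA⟩ := nonempty_singularHomology_arcStrip_iso R M (K := K) 0
  haveI := ModuleCat.subsingleton_of_isZero (isZero_relativeSingularHomology_circleArcStrip_zero R M (K := K))
  let e : (singularHomology R M (circleArcStrip K) 0 ×
      relativeSingularHomology R M (AddCircle (1 : ℝ) × K) (circleArcStrip K) 0) ≃ₗ[R]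
        singularHomology R M (circleArcStrip K) 0 :=
    LinearEquiv.ofBijective (LinearMap.fst R _ _)
      ⟨fun x y h => Prod.ext h (Subsingleton.elim _ _), fun a => ⟨(a, 0), rfl⟩⟩
  exact ⟨circleArcStripSplitEquiv R M 0 ≪≫ₗ e ≪≫ₗ eA.toLinearEquiv⟩

/-- `Hₖ₊₁(K × S¹; M) ≅ Hₖ₊₁(K; M) ⊕ Hₖ(K; M)` (factors swapped). [cite: HatcherAT2002, §3.B Cor. 3B.7] -/
theorem nonempty_singularHomology_prodCircle_equiv_succ (k : ℕ) :
    Nonempty (singularHomology R M (K × AddCircle (1 : ℝ)) (k + 1) ≃ₗ[R]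
      singularHomology R M K (k + 1) × singularHomology R M K k) := by
  obtain ⟨e⟩ := nonempty_singularHomology_circleProd_equiv_succ R M (K := K) k
  exact ⟨(singularHomology.mapIso R M (Homeomorph.prodComm K (AddCircle (1 : ℝ))) (k + 1)).toLinearEquiv ≪≫ₗ e⟩

/-- `H₀(K × S¹; M) ≅ H₀(K; M)` (factors swapped). [cite: HatcherAT2002, §3.B Cor. 3B.7] -/
theorem nonempty_singularHomology_prodCircle_equiv_zero :
    Nonempty (singularHomology R M (K × AddCircle (1 : ℝ)) 0 ≃ₗ[R] singularHomology R M K 0) := by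
  obtain ⟨e⟩ := nonempty_singularHomology_circleProd_equiv_zero R M (K := K)
  exact ⟨(singularHomology.mapIso R M (Homeomorph.prodComm K (AddCircle (1 : ℝ))) 0).toLinearEquiv ≪≫ₗ e⟩

end Split

/-! ### The homology of the torus is free of rank `(n choose k)` -/

section TorusHomology

variable (R : Type v) [CommRing R] (M : Type v) [AddCommGroup M] [Module R M]

/-- `(Fin a → M) × (Fin b → M) ≃ₗ (Fin c → M)` for `c = a + b`. [folklore] -/
def finArrowProdEquiv {a b c : ℕ} (h : c = a + b) : ((Fin a → M) × (Fin b → M)) ≃ₗ[R] (Fin c → M) :=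
  (LinearEquiv.sumArrowLequivProdArrow (Fin a) (Fin b) R M).symm ≪≫ₗ
    LinearEquiv.funCongrLeft R M ((finCongr h).trans finSumFinEquiv.symm)

/-- **`Hₖ(Tⁿ; M) ≅ M^(n choose k)`** for the torus `Tⁿ = (ℝ/ℤ)ⁿ` and every coefficient module `M`
(Hatcher 2002, §3.3 p. 231: "`Hₖ(Tⁿ; ℤ)` is isomorphic to the direct sum of `(n choose k)` copies of
`ℤ`"), by induction through `Tⁿ⁺¹ ≃ Tⁿ × S¹` and the splitting
`Hₖ₊₁(K × S¹) ≅ Hₖ₊₁(K) ⊕ Hₖ(K)`, with Pascal's rule. [cite: HatcherAT2002, §3.3 p. 231] -/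
theorem nonempty_singularHomology_torus_equiv (n k : ℕ) :
    Nonempty (singularHomology R M (Torus n) k ≃ₗ[R] (Fin (n.choose k) → M)) := by
  induction n generalizing k with
  | zero =>
    cases k with
    | zero =>
      exact ⟨singularHomology.zeroLinearEquivOfPathConnected R M (Torus 0) ≪≫ₗ
        (LinearEquiv.funUnique (Fin 1) R M).symm⟩
    | succ k =>
      haveI := ModuleCat.subsingleton_of_isZero
        (isZero_singularHomology_of_subsingleton R M (X := Torus 0) (Nat.succ_ne_zero k))
      exact ⟨LinearEquiv.ofSubsingleton _ (Fin 0 → M) ≪≫ₗ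
        LinearEquiv.funCongrLeft R M (finCongr (Nat.choose_zero_succ k))⟩
  | succ n ih =>
    cases k with
    | zero =>
      obtain ⟨e⟩ := nonempty_singularHomology_prodCircle_equiv_zero R M (K := Torus n)
      obtain ⟨e'⟩ := ih 0
      exact ⟨(singularHomology.mapIso R M (torusSplit n) 0).toLinearEquiv ≪≫ₗ e ≪≫ₗ e' ≪≫ₗ
        LinearEquiv.funCongrLeft R M (finCongr (by simp))⟩
    | succ k =>
      obtain ⟨e⟩ := nonempty_singularHomology_prodCircle_equiv_succ R M (K := Torus n) k
      obtain ⟨e₁⟩ := ih (k + 1)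
      obtain ⟨e₂⟩ := ih k
      exact ⟨(singularHomology.mapIso R M (torusSplit n) (k + 1)).toLinearEquiv ≪≫ₗ e ≪≫ₗ
        e₁.prodCongr e₂ ≪≫ₗ finArrowProdEquiv R M (by rw [Nat.choose_succ_succ, Nat.add_comm])⟩

end TorusHomology

end Literature.AlgebraicTopology.SingularHomology
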